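import Summits.AtomisticToContinuum.BoseEinsteinCondensation.Theorems.PeriodicIRBound.Negative.AEClass
import Summits.AtomisticToContinuum.BoseEinsteinCondensation.Theorems.PeriodicIRBound.Negative.AeZeroPotential
import Summits.AtomisticToContinuum.BoseEinsteinCondensation.Theorems.CorrectorClosure.Negative.InsertionResidueOneExcitationState
import Literature.MathematicalPhysics.QuantumManyBody.BoseGasDirichletWall

/-!
# Negative lemmas for crux `PeriodicIRBound` (stmt-AtomisticToContinuum-3972), XIII: targets for the
line `linear-ph-floor-wagner`

Supports (does not close) stmt-AtomisticToContinuum-3972, route `BECGroundStateSOS`. Landed copy of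
§22 of `Cruxes/PeriodicIRBound/Disproof.lean` (cycle 3, gen-3 disprover seat); all `sorry`-free,
axioms `propext`/`Classical.choice`/`Quot.sound`. `LinearFloorFor`, `ZeroMomentumGapFor` are VERBATIM
copies of the §1 definitions of the registered skeleton
`Cruxes/PeriodicIRBound/Lines/linear-ph-floor-wagner.lean`; nothing below asserts a Theses decl.

* (tools) a private free Bijl–Feynman bound (free sector energies `≤ |2πn/L|²` via the symmetrised
  plane wave = `CorrectorClosure.Negative.affineState (0,1)`; public twin in the drefute seat's
  `LinearFloorGuards.lean`), and `Negative.AeZeroPotential` (drefute: `momentumSectorEnergy_zero_particles`,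
  `zeroMomentumGapFor_free`) imported rather than re-proved.
* `not_linearFloorFor_freeGas`, `not_linearParticleHoleFloorUnguarded`, `linearFloorFor_congr_ae`,
  `not_linearFloorFor_of_ae_zero`, `scatteringLength_pos_of_linearFloorFor` — the line's transfer
  target `C⁺ = LinearFloorFor v` FAILS for every a.e.-free admissible `v`; its guard `∫v ≠ 0` and the
  case split of `stub_transfer` are load-bearing; `C⁺(v) ⇒ 0 < scatteringLength v`.
* `zeroMomentumGapFor_zero`, `zeroMomentumGapFor_of_ae_zero` — the gap hypothesis of `stub_transfer`
  HOLDS for a.e.-free gases (no guard needed there).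
* `groundOccupation_zero_eq_zero` (`γ^{free}_N(k) = 0`, `k ≠ 0`), `wagnerFeynmanWith_zero`,
  `wagnerFeynmanWith_of_ae_zero` — the lead's reshaped stub 5b statement `WagnerFeynmanWith v A`
  (verbatim copy) holds for (a.e.-)free gases with EVERY constant `A`: consistent, and blind to `A`.
-/

noncomputable section

open MeasureTheory Filter
open scoped ENNReal NNReal ComplexConjugate BigOperators
namespace Summit.AtomisticToContinuum.BoseEinsteinCondensation.Theorems.PeriodicIRBound.Negative

open Literature.MathematicalPhysics.QuantumManyBody.BoseGas
open Summit.AtomisticToContinuum.BoseEinsteinCondensation.Theses.BECGroundStateSOS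
open Summit.AtomisticToContinuum.BoseEinsteinCondensation.Theorems.GaussianDominationCan.Negative
  (isRepulsiveFiniteRange_zero nsq)

/-! All declarations of this file live in the sub-namespace `…Negative.LinearFloorTargets` (the defs
`LinearFloorFor`, `ZeroMomentumGapFor`, `WagnerFeynmanWith` mirror the skeleton's and must not collide
with sibling Negative files or the lead's Defs module). -/
namespace LinearFloorTargets

variable {L : ℝ}

/-! ## §22 TARGETS — the registered skeleton `Lines/linear-ph-floor-wagner.lean` (6 stubs)

(cycle 3; payload `targets`/`stuck_stubs` empty — pre-emptive pass over the registered stubs of the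
only line, whose closed term `PeriodicIRBound_of` concludes the crux from `stub_landauSectorBound`
(= stmt-9091 verbatim), `stub_energyConvexity` (= stmt-9094), `stub_zeroMomentumGround` (= stmt-11845),
`stub_linearFloor_of_landau`, `stub_transfer`, `stub_hardCore`; the LEAD'S RESHAPE (wave 1,
2026-08-16) splits `stub_transfer` into `stub_wagnerFeynman : WagnerFeynmanBound` (two-sided moment
bound for `γ_N(k)` at fixed `(N,L)`, one absolute constant `A`) and `stub_transferArith :
TransferArith`, 7 stubs, statements to land as `Theorems/BECGroundStateSOSPeriodicIRBoundDefs.lean`.)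
VERDICT: no stub is killed — stubs 1–3 are sibling-route items of open-problem / textbook strength
whose typed forms pass the degenerate checks (empty sectors are `⊤`, `a = 0` collapses 9091's window,
9094 is trivial at `a = 0`); stubs 4, 5b, 5c, 6 are material implications / bounds with (expected)
true conclusions (`WagnerFeynmanWith v 1` is the exact CCR identity
`n_pΓ_N(p) ≤ ⟨[[a_p,H],a_p†]⟩ = |p|² + L⁻³(v̂(0)N + Σ_q v̂(q-p)n_q) ≤ |p|² + 2N‖v‖₁/L³` for the true
ground state). What IS checkable is which guards are load-bearing and where the free gas sits:

* `not_linearFloorFor_zero`, `not_linearParticleHoleFloorUnguarded`,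
  `not_linearFloorFor_of_ae_zero`, `scatteringLength_pos_of_linearFloorFor` — the line's transfer
  target `C⁺ = LinearFloorFor v` (linear particle–hole floor `Γ_N(k) ≥ 2θ√ρ|k|`) is FALSE for the
  free gas and for every a.e.-free admissible `v`: `Γ_N^{free}(2πe₁/L_N) ≤ 2·4π²/L_N² = o(√ρ/L_N)`
  (symmetrised plane waves in the `N ± 1` sectors, `momentumSectorEnergy_zero_latticeVec_le`). So
  the guard `∫v ≠ 0` in `LinearParticleHoleFloor`, the hypothesis shape `(∫v ≠ 0 → LinearFloorFor v)`
  and the case split of `stub_transfer` are all NECESSARY, and `C⁺(v)` forces `a(v) > 0`: the linear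
  floor is an interaction effect (Bogoliubov `Γ_N ≈ 2c_s|k| + 8πa/L³`), unlike the crux itself,
  which holds at `a = 0` (§9, §21).
* `zeroMomentumGapFor_zero` — by contrast the gap hypothesis `ZeroMomentumGapFor` of `stub_transfer`
  HOLDS for the free gas (`0 < |q|²/N ≤ E_N(q)`; empty sectors for `N = 0`,
  `momentumSectorEnergy_zero_particles`), so it needs no guard; 11845's exclusion `∫v ≠ ⊤` is about
  `E₀ = ⊤` (jammed hard cores, §7), not about `a = 0`.
* `groundOccupation_zero_eq_zero`, `wagnerFeynmanWith_zero`, `wagnerFeynmanWith_of_ae_zero` — the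
  free (and every a.e.-free) gas is FULLY CONDENSED in γ-form, `γ_N^{free}(k) = 0` for `k ≠ 0`
  (kinetic Markov `n_k ≤ δL²/4π²|k|²`, `δ ↓ 0`), so it satisfies the lead's `WagnerFeynmanWith v A`
  with EVERY constant `A` and cannot probe the absolute constant of `WagnerFeynmanBound` (expected
  `A = 1` by the CCR identity); a refutation of stub 5b would need a LOWER bound on `γ_N(k)` of an
  interacting gas, i.e. the sibling crux `InfraredMinimumUncertainty` (stmt-11784) — not in print.
* Not formalisable as kills: `stub_linearFloor_of_landau` is provable as planned (9091 at `N ± 1`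
  in the box `L_N`, densities `ρ(N±1)/N ∈ [ρ/2, 2ρ]` for `N ≥ 2`, `M₀ := √(C/a)`; 9094 with
  `ε := πθ` absorbed via `|k| ≥ 2π/L_N`; off-lattice `k` give `⊤`); `stub_transfer`'s operator
  identity `Q_{N-1}(aΦ) + Q_{N+1}(a†Φ) = ⟨[[a,H],a†]⟩ + 2Re⟨HΦ,n̂Φ⟩ + Q_N(Φ)` and
  `⟨[[a_p,H],a_p†]⟩ ≤ |p|² + 2ρ‖v‖₁` check on paper (CCR algebra; `|v̂(q)| ≤ v̂(0)` for `v ≥ 0`);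
  its monotonicity input `E₀(N+1,L) ≥ E₀(N,L)` (`v ≥ 0`, slice-wise variational principle) is
  sound. The WINDOW of `C⁺` is consistent with Landau physics: momenta `|k| ≤ √(Cρ)` lie below the
  inverse healing length scale up to constants and vortex rings with such momenta have radius
  `R ≲ C^{1/4}ρ^{-1/4} ≪ ξ ∼ (aρ)^{-1/2}` as `ρ → 0`, so no ring/soft branch enters the window
  (the Galilean branch `E₀ + |K|²/M` lives at `|K| ∈ (2πM/L)ℤ³ ∖ 0`, astronomically outside).
* CONSTANTS (information for the lead, no Lean object): `TransferArith` yields the crux constant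
  `C(v,κ) = A(π√3κ² + ‖v‖₁/4π)/θ₀(v)`, growing like `κ²`, whereas Bogoliubov's `sup_p |p|n_p/√ρ =
  √(πa)` is `κ`-UNIFORM. The loss is the dropped particle-channel term: the two-sided identity gives
  `n_pΓ_N(p) ≤ D - (E_{N+1}(p) - E₀(N))`, and at `|p| ≫ √(aρ)` one has `E_{N+1}(p) - E₀(N+1) ≈ E_p ≥ p²`
  (Bogoliubov `E_p = √(p⁴ + 16πaρp²) ≥ p²` for ALL `p`), which cancels the `p²` of
  `D = p² + L⁻³(v̂(0)N + Σ v̂(q-p)n_q)` and leaves `n_p ≲ ρ(2‖v‖₁ - 8πa)/Γ_N(p)`: a floor of the shape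
  `Γ_N(p) ≥ 2 max(θ√ρ|p|, (1-ε)p²)` (linear in the phonon window, QUADRATIC = free-particle beyond it,
  i.e. `C⁺` joined with an honest large-momentum `SectorGapFloor`) would make `C` uniform in `κ`; the
  crux as typed (`C = C(v,κ)`) does not require this. -/

section Targets

variable {M : ℕ}

open Summit.AtomisticToContinuum.BoseEinsteinCondensation.Theorems.CorrectorClosure.Negative
  (affineState momSq momSq_nonneg periodicEnergy_zero_affineState_le)

/-- The normalised symmetrised plane wave `N_k 1/‖N_k 1‖` (the tree's `affineState` with
`(a,b) = (0,1)`) lies in the sector `k = 2πn/L`. [folklore] -/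
private theorem hasTotalMomentum_affineState_zero_one (hL : 0 < L) (hM : 0 < M) {n : Fin 3 → ℤ}
    (hn : n ≠ 0) :
    HasTotalMomentum (latticeVec (2 * Real.pi / L) n)
      (affineState hL hM hn (a := 0) (b := 1) (Or.inr one_ne_zero)).ψ := by
  have h : HasTotalMomentum (latticeVec (2 * Real.pi / L) n)
      (fun Y : Config M => (0 : ℂ) + 1 * planeWaveSum L n Y) := by
    have hfun : (fun Y : Config M => (0 : ℂ) + 1 * planeWaveSum L n Y) = planeWaveSum L n := by
      funext Y; simp
    rw [hfun]
    exact hasTotalMomentum_planeWaveSum L n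
  unfold affineState
  exact h.ofFun _ _ _ _ _

/-- **Free sector energies cost at most one quantum**: for the free gas and `M ≥ 1` particles,
`inf sp H^{L,M}_{free}(2πn/L) ≤ |2πn/L|²` (trial state: the symmetrised plane wave; private twin of the
drefute seat's `momentumSectorEnergy_zero_latticeVec_le` in `LinearFloorGuards.lean`). [folklore] -/
private theorem free_sectorEnergy_latticeVec_le (hL : 0 < L) (hM : 0 < M) {n : Fin 3 → ℤ}
    (hn : n ≠ 0) :
    momentumSectorEnergy 0 M L (latticeVec (2 * Real.pi / L) n) ≤ ENNReal.ofReal (momSq L n) :=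
  (momentumSectorEnergy_le 0 _ (hasTotalMomentum_affineState_zero_one hL hM hn)).trans
    (periodicEnergy_zero_affineState_le hL hM hn _)

/-- The two unit vectors `e0` of the tree (cruxes `GaussianDominationCan`, `CorrectorClosure`)
coincide. [folklore] -/
theorem e0_eq_e0 :
    Summit.AtomisticToContinuum.BoseEinsteinCondensation.Theorems.CorrectorClosure.Negative.e0 =
      Summit.AtomisticToContinuum.BoseEinsteinCondensation.Theorems.GaussianDominationCan.Negative.e0 :=
  rfl

/-- `h e₁` as a Euclidean vector. [folklore] -/
theorem latticeVec_e0 (h : ℝ) :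
    latticeVec h Summit.AtomisticToContinuum.BoseEinsteinCondensation.Theorems.CorrectorClosure.Negative.e0 =
      EuclideanSpace.single 0 h := by
  ext a
  simp only [latticeVec, PiLp.toLp_apply,
    Summit.AtomisticToContinuum.BoseEinsteinCondensation.Theorems.CorrectorClosure.Negative.e0,
    EuclideanSpace.single, PiLp.single_apply]
  fin_cases a <;> simp

/-- `‖h e₁‖ = h` for `h ≥ 0`. [folklore] -/
theorem norm_latticeVec_e0 {h : ℝ} (hh : 0 ≤ h) :
    ‖latticeVec h Summit.AtomisticToContinuum.BoseEinsteinCondensation.Theorems.CorrectorClosure.Negative.e0‖ = h := by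
  rw [latticeVec_e0, EuclideanSpace.single, PiLp.norm_single, Real.norm_of_nonneg hh]

/-- **`C⁺` of the line, per potential** — VERBATIM copy of `LinearFloorFor` from
`Cruxes/PeriodicIRBound/Lines/linear-ph-floor-wagner.lean` §1 (the LINEAR particle–hole sector floor
`2E₀(N) + 2θ√ρ|k| ≤ E_{N+1}(k) + E_{N-1}(k)` on `|k|² ≤ Cρ`, eventually in `N`, for small `ρ`). -/
def LinearFloorFor (v : ℝ → ℝ≥0∞) : Prop :=
  ∀ C : ℝ, 0 < C → ∃ θ : ℝ, 0 < θ ∧ ∃ ρ₀ : ℝ, 0 < ρ₀ ∧ ∀ ρ : ℝ, 0 < ρ → ρ < ρ₀ →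
    ∀ᶠ N : ℕ in atTop, ∀ k : Space, k ≠ 0 → ‖k‖ ^ 2 ≤ C * ρ →
      2 * periodicGroundStateEnergy v N (sideLength ρ N) +
          ENNReal.ofReal (2 * θ * Real.sqrt ρ * ‖k‖) ≤
        momentumSectorEnergy v (N + 1) (sideLength ρ N) k +
          momentumSectorEnergy v (N - 1) (sideLength ρ N) k

/-- **The free gas violates the linear particle–hole floor** (`¬ C⁺(0)`): at the bottom mode
`k = 2πe₁/L_N` one has `E₀ = 0 ≥ 0` and `E_{N±1}(k) ≤ |k|² = 4π²/L_N²` (symmetrised plane waves),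
so `Γ_N^{free}(k) ≤ 2|k|²`, while the floor asks `2θ√ρ|k|` with `|k| = 2π/L_N → 0`. Hence the
guard `∫v ≠ 0` in the line's `LinearParticleHoleFloor` and the case split `∫v = 0`/`∫v ≠ 0`
inside `stub_transfer` are LOAD-BEARING: the linear floor is an INTERACTION effect (Bogoliubov
`Γ_N(k) ≈ 2c_s|k| + 8πa/L³`, `c_s = 4√(πaρ)`), absent at `a = 0` — whereas the crux itself HOLDS
at `v = 0` (§9 `irBoundFor_zero`). [folklore] -/
theorem not_linearFloorFor_freeGas : ¬ LinearFloorFor 0 := by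
  intro h
  obtain ⟨θ, hθ, ρ₀, hρ₀, h⟩ := h 1 one_pos
  set ρ : ℝ := ρ₀ / 2 with hρdef
  have hρ : 0 < ρ := by positivity
  have hρρ₀ : ρ < ρ₀ := by rw [hρdef]; linarith
  have hsq : 0 < Real.sqrt ρ := Real.sqrt_pos.2 hρ
  set B : ℝ := max (2 * Real.pi / Real.sqrt ρ) (2 * Real.pi / (θ * Real.sqrt ρ)) + 1 with hB
  obtain ⟨N, hN, hN2, hNL⟩ := ((h ρ hρ hρρ₀).and ((eventually_ge_atTop 2).and
    ((tendsto_sideLength_atTop hρ).eventually_ge_atTop B))).exists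
  set L := sideLength ρ N with hLdef
  have hNpos : 0 < N := lt_of_lt_of_le (by norm_num) hN2
  have hL : 0 < L := sideLength_pos_of_pos hρ hNpos
  have hL1 : 2 * Real.pi / Real.sqrt ρ < L :=
    lt_of_lt_of_le (lt_of_le_of_lt (le_max_left _ _) (lt_add_one _)) hNL
  have hL2 : 2 * Real.pi / (θ * Real.sqrt ρ) < L :=
    lt_of_lt_of_le (lt_of_le_of_lt (le_max_right _ _) (lt_add_one _)) hNL
  set e := Summit.AtomisticToContinuum.BoseEinsteinCondensation.Theorems.CorrectorClosure.Negative.e0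
    with he
  have he0 : e ≠ 0 := by
    intro h0
    have := congr_fun h0 0
    simp [he, Summit.AtomisticToContinuum.BoseEinsteinCondensation.Theorems.CorrectorClosure.Negative.e0]
      at this
  set k : Space := latticeVec (2 * Real.pi / L) e with hk
  have hkn : ‖k‖ = 2 * Real.pi / L := norm_latticeVec_e0 (by positivity)
  have hkpos : 0 < ‖k‖ := by rw [hkn]; positivity
  have hk0 : k ≠ 0 := norm_pos_iff.1 hkpos
  -- the bottom mode is in the window `‖k‖² ≤ 1·ρ`
  have hkw : ‖k‖ ^ 2 ≤ 1 * ρ := by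
    rw [one_mul, hkn]
    have h1 : 2 * Real.pi / L ≤ Real.sqrt ρ := by
      rw [div_le_iff₀ hL]
      rw [div_lt_iff₀ hsq] at hL1
      linarith
    calc (2 * Real.pi / L) ^ 2 ≤ Real.sqrt ρ ^ 2 := by gcongr
      _ = ρ := Real.sq_sqrt hρ.le
  have key := hN k hk0 hkw
  -- upper bounds on the two sector energies by the symmetrised plane waves
  have hup : momentumSectorEnergy 0 (N + 1) L k + momentumSectorEnergy 0 (N - 1) L k ≤
      ENNReal.ofReal (momSq L e) + ENNReal.ofReal (momSq L e) :=
    add_le_add (free_sectorEnergy_latticeVec_le hL (Nat.succ_pos N) he0)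
      (free_sectorEnergy_latticeVec_le hL (by omega) he0)
  have hlow : ENNReal.ofReal (2 * θ * Real.sqrt ρ * ‖k‖) ≤
      2 * periodicGroundStateEnergy 0 N L + ENNReal.ofReal (2 * θ * Real.sqrt ρ * ‖k‖) :=
    le_add_self
  have hfin := (hlow.trans key).trans hup
  rw [← ENNReal.ofReal_add (momSq_nonneg L e) (momSq_nonneg L e),
    ENNReal.ofReal_le_ofReal_iff (add_nonneg (momSq_nonneg L e) (momSq_nonneg L e)),
    Summit.AtomisticToContinuum.BoseEinsteinCondensation.Theorems.CorrectorClosure.Negative.momSq_e0,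
    hkn] at hfin
  -- `2θ√ρ (2π/L) ≤ 2 (2π/L)²` forces `θ√ρ ≤ 2π/L`, contradicting `L > 2π/(θ√ρ)`
  have hc : θ * Real.sqrt ρ ≤ 2 * Real.pi / L := by
    have h2 : 0 < 2 * Real.pi / L := by positivity
    nlinarith
  rw [div_lt_iff₀ (mul_pos hθ hsq)] at hL2
  rw [le_div_iff₀ hL] at hc
  linarith

/-- The line's global `C⁺` with the guard `∫v ≠ 0` DROPPED: "the linear floor for every repulsive
finite-range `v`". -/
def LinearParticleHoleFloorUnguarded : Prop :=
  ∀ v : ℝ → ℝ≥0∞, IsRepulsiveFiniteRange v → LinearFloorFor v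

/-- **The guard `∫v ≠ 0` of `LinearParticleHoleFloor` is load-bearing**: unguarded, `C⁺` is
false (witness `v = 0`, admissible). [folklore] -/
theorem not_linearParticleHoleFloorUnguarded : ¬ LinearParticleHoleFloorUnguarded :=
  fun h => not_linearFloorFor_freeGas (h 0 isRepulsiveFiniteRange_zero)

/-- `C⁺` sees only the a.e.-class of `v ∘ |·|` (§21). [folklore] -/
theorem linearFloorFor_congr_ae {v w : ℝ → ℝ≥0∞} (h : ∀ᵐ x : Space, v ‖x‖ = w ‖x‖) :
    LinearFloorFor v ↔ LinearFloorFor w := by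
  unfold LinearFloorFor
  simp only [periodicGroundStateEnergy_congr_ae h, momentumSectorEnergy_congr_ae h]

/-- **No a.e.-free admissible `v` has the linear floor** (the guard must be `∫v ≠ 0`, i.e.
"not a.e. zero", exactly as the line types it — a weaker guard such as `v ≠ 0` would not do:
`v = ⊤·1_S`, `S` null, is admissible, `≠ 0`, and violates `C⁺`). [folklore] -/
theorem not_linearFloorFor_of_ae_zero {v : ℝ → ℝ≥0∞} (h : ∀ᵐ x : Space, v ‖x‖ = 0) :
    ¬ LinearFloorFor v := fun hv =>
  not_linearFloorFor_freeGas ((linearFloorFor_congr_ae (w := 0) (by simpa using h)).1 hv)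

/-- **`C⁺(v)` forces a positive scattering length**: for admissible `v`, `LinearFloorFor v` implies
`0 < scatteringLength v` (contrapositive of `LSSY2005_zeroScatteringLength_holds` and
`not_linearFloorFor_of_ae_zero`). The linear particle–hole floor is an interaction effect; the
`θ` it produces must vanish with `a` (Bogoliubov: `θ < 4√(πa)`). [folklore] -/
theorem scatteringLength_pos_of_linearFloorFor {v : ℝ → ℝ≥0∞} (hv : IsRepulsiveFiniteRange v)
    (h : LinearFloorFor v) : 0 < scatteringLength v := by
  rw [pos_iff_ne_zero]
  intro ha
  obtain ⟨R₀, hR₀⟩ := hv.2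
  exact not_linearFloorFor_of_ae_zero (LSSY2005_zeroScatteringLength_holds v R₀ hv.1 hR₀ ha) h

/-- **Zero-momentum gap at fixed `(N, L)`, per potential** — VERBATIM copy of `ZeroMomentumGapFor`
from the line (§1): `E₀^per(N,L) < E^per_N(q;L)` for every `q ≠ 0` (stmt-11845 is
`∀ v` integrable admissible, `ZeroMomentumGapFor v`). -/
def ZeroMomentumGapFor (v : ℝ → ℝ≥0∞) : Prop :=
  ∀ (N : ℕ) (L : ℝ), 0 < L → ∀ q : Space, q ≠ 0 →
    periodicGroundStateEnergy v N L < momentumSectorEnergy v N L q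

/-- **Consistency of `stub_zeroMomentumGround` at `v = 0`**: the free gas HAS the fixed-`(N,L)`
zero-momentum gap (`E₀ = 0 < |q|²/N ≤ E_N(q)` by the centre-of-mass bound; empty sectors for
`N = 0`) — the drefute seat's `zeroMomentumGapFor_free` (`Negative.AeZeroPotential`), read through the
def. So, unlike `C⁺`, the gap hypothesis of `stub_transfer` needs no `∫v ≠ 0` guard. [folklore] -/
theorem zeroMomentumGapFor_zero : ZeroMomentumGapFor 0 :=
  zeroMomentumGapFor_free

/-- `ZeroMomentumGapFor` sees only the a.e.-class of `v ∘ |·|`; in particular EVERY a.e.-free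
admissible `v` has the gap. [folklore] -/
theorem zeroMomentumGapFor_of_ae_zero {v : ℝ → ℝ≥0∞} (h : ∀ᵐ x : Space, v ‖x‖ = 0) :
    ZeroMomentumGapFor v := by
  intro N L hL q hq
  have h' : ∀ᵐ x : Space, v ‖x‖ = (0 : ℝ → ℝ≥0∞) ‖x‖ := by simpa using h
  rw [periodicGroundStateEnergy_congr_ae h', momentumSectorEnergy_congr_ae h']
  exact zeroMomentumGapFor_zero N L hL q hq

/-- **The free gas is fully condensed in γ-form**: `γ_N^{free}(k) = 0` for every `k ≠ 0` (kinetic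
Markov bound `n_k(Ψ) ≤ ⟨Ψ,-ΔΨ⟩ L²/(4π²|k|²)` on `δ`-near-minimisers of `E₀^{free} = 0`, then
`δ ↓ 0`). [folklore] -/
theorem groundOccupation_zero_eq_zero (hL : 0 < L) (N : ℕ) {k : Fin 3 → ℤ} (hk : k ≠ 0) :
    groundOccupation 0 N L k = 0 := by
  refine le_antisymm (ENNReal.le_of_forall_pos_le_add fun ε hε _ => ?_) bot_le
  rw [zero_add]
  set D := fracDispersion 2 L k with hDdef
  have hpos : 0 < 4 * Real.pi ^ 2 * nsq k / L ^ 2 :=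
    div_pos (mul_pos (by positivity) (by linarith [one_le_nsq hk])) (pow_pos hL 2)
  have hD0 : D ≠ 0 := by
    rw [hDdef, fracDispersion_two_nsq]; exact (ENNReal.ofReal_pos.2 hpos).ne'
  have hDtop : D ≠ ⊤ := fracDispersion_ne_top 2 L k
  have hε0 : (ε : ℝ≥0∞) ≠ 0 := by exact_mod_cast hε.ne'
  have hδ : 0 < (ε : ℝ≥0∞) * D := pos_iff_ne_zero.2 (mul_ne_zero hε0 hD0)
  calc groundOccupation 0 N L k
      ≤ ⨆ (Ψ : PeriodicTrialState N L)
          (_ : periodicEnergy 0 Ψ ≤ periodicGroundStateEnergy 0 N L + (ε : ℝ≥0∞) * D),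
          cellOccupation N L (planeWaveMode L k) Ψ.ψ := iInf₂_le _ hδ
    _ ≤ (ε : ℝ≥0∞) := iSup₂_le fun Ψ hΨ => by
        rw [periodicGroundStateEnergy_zero_eq_zero N hL, zero_add] at hΨ
        calc cellOccupation N L (planeWaveMode L k) Ψ.ψ
            ≤ periodicEnergy 0 Ψ / D := cellOccupation_le_energy_div hL 0 Ψ hk
          _ ≤ (ε : ℝ≥0∞) * D / D := by gcongr
          _ = ε := ENNReal.mul_div_cancel_right hD0 hDtop

/-- **The Wagner–Feynman moment bound with constant `A`, per potential, at fixed `(N, L)`** — VERBATIM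
copy of `WagnerFeynmanWith` from the lead's reshaped skeleton (§2): whenever the particle–hole sector
sum at `p = 2πk/L` exceeds `2E₀` by `θ ≥ 0`, `γ_N(k)·θ ≤ A(‖p‖² + N‖v‖₁/L³)`. -/
def WagnerFeynmanWith (v : ℝ → ℝ≥0∞) (A : ℝ) : Prop :=
  ∀ (N : ℕ) (L : ℝ), 2 ≤ N → 0 < L → periodicGroundStateEnergy v N L ≠ ⊤ →
    ∀ k : Fin 3 → ℤ, k ≠ 0 → ∀ θ : ℝ, 0 ≤ θ →
      2 * periodicGroundStateEnergy v N L + ENNReal.ofReal θ ≤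
          momentumSectorEnergy v (N + 1) L (latticeVec (2 * Real.pi / L) k) +
            momentumSectorEnergy v (N - 1) L (latticeVec (2 * Real.pi / L) k) →
      groundOccupation v N L k * ENNReal.ofReal θ ≤
        ENNReal.ofReal (A * (‖latticeVec (2 * Real.pi / L) k‖ ^ 2 +
          N * (∫⁻ x : Space, v ‖x‖).toReal / L ^ 3))

/-- **The free gas satisfies the Wagner–Feynman bound with EVERY constant** (`γ^{free} = 0`): stub 5b
is consistent at `v = 0`, and the free gas cannot probe its absolute constant `A`. [folklore] -/
theorem wagnerFeynmanWith_zero (A : ℝ) : WagnerFeynmanWith 0 A := by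
  intro N L _ hL _ k hk θ _ _
  rw [groundOccupation_zero_eq_zero hL N hk, zero_mul]
  exact bot_le

/-- … and so does every a.e.-free `v` (§21). [folklore] -/
theorem wagnerFeynmanWith_of_ae_zero {v : ℝ → ℝ≥0∞} (h : ∀ᵐ x : Space, v ‖x‖ = 0) (A : ℝ) :
    WagnerFeynmanWith v A := by
  intro N L _ hL _ k hk θ _ _
  have h' : ∀ᵐ x : Space, v ‖x‖ = (0 : ℝ → ℝ≥0∞) ‖x‖ := by simpa using h
  rw [groundOccupation_congr_ae h', groundOccupation_zero_eq_zero hL N hk, zero_mul]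
  exact bot_le

end Targets

end LinearFloorTargets


end Summit.AtomisticToContinuum.BoseEinsteinCondensation.Theorems.PeriodicIRBound.Negative

end
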